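import Summits.AtomisticToContinuum.HydrodynamicLimit.Theorems.AntiMazurCoboundariesCorrectorPressureDecayKiferSetwiseUpgradeSigma
import Summits.AtomisticToContinuum.HydrodynamicLimit.Theorems.AntiMazurCoboundariesCorrectorPressureDecayKiferSetwiseUpgradeLaplace
import Summits.AtomisticToContinuum.HydrodynamicLimit.Theorems.AntiMazurCoboundariesCorrectorPressureDecayKiferEntropyLscDensity
import Summits.AtomisticToContinuum.HydrodynamicLimit.Theorems.AntiMazurCoboundariesCorrectorPressureDecayKiferCanonicalLocalLimitTranslation

/-!
# Setwise upgrade of vague convergence under window domination (line `FirstLemma`, crux stmt-AtomisticToContinuum-14135)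

Registered stub `stub_setwiseWindowLimit_of_domination` of skeleton v10 of line `FirstLemma` (idea `kifer-compactification`),
namespace `Summit.AtomisticToContinuum.HydrodynamicLimit.Theorems.KiferCompactification` — step (E1-iv) of the compactness
half of Georgii's equivalence of ensembles: if the Laplace functionals of probability laws `P k` on the locally finite
configurations of `ℝ³ × ℝ³` converge to those of a probability law `μ` on all of `C_c⁺`, and on every centred cube `Λ_n`
the window laws `windowLaw Λ_n (P k)` are dominated, uniformly in `k`, by one finite measure, then the window laws
converge SETWISE on every bounded measurable window `Λ`: `windowLaw Λ (P k) A → windowLaw Λ μ A` for every measurable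
`A`, along the full sequence.

Proof. Put `Λ` inside an open ball `U` inside a centred cube `Λ_n`. The event `E = {ω | ω ∩ (Λ × ℝ³) ∈ A}` is an event
of the configuration seen in the OPEN set `V = U × ℝ³`, hence (`measurable_restrict_iSup_comap`,
`…KiferSetwiseUpgradeSigma.lean`) of the σ-algebra generated by the exponential statistics `e^{-S_f}`, `f ∈ C_c⁺` with
`tsupport f ⊆ V`. By the functional monotone class theorem in `L¹` form (`stub_cylinderDenseL1`) its indicator is
`ε`-close in `L¹(R + μ)` to a continuous — after clamping, bounded continuous — function `G` of finitely many such
statistics; `∫ G dP_k → ∫ G dμ` by the sequential Stone–Weierstrass step on Laplace functionals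
(`tendsto_integral_bcf_expNegSumFn`, `…KiferSetwiseUpgradeLaplace.lean`). Both `1_E` and `G` only see the configuration
in `Λ_n × ℝ³`, so the domination `windowLaw Λ_n (P k) ≤ R` turns the `L¹(R)`-bound into a bound UNIFORM in `k`:
`|P_k E - μ E| ≤ 2ε + |∫ G dP_k - ∫ G dμ|` (`tendsto_measure_of_forall_approx`). The intensity hypotheses of the
registered signature (no points on the boundary of the cube) are not needed on this route. No new definitions.

References: O. Kallenberg, *Foundations of Modern Probability*, 2nd ed. (2002), Lemma 12.1, Thm. 16.16;
H.-O. Georgii, J. Stat. Phys. 80 (1995) §3.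
-/

noncomputable section

open MeasureTheory Set Filter Topology Function
open scoped ENNReal NNReal BoundedContinuousFunction

namespace Summit.AtomisticToContinuum.HydrodynamicLimit.Theorems.KiferCompactification

open Literature.MathematicalPhysics.KineticTheory (V3)
open Literature.MathematicalPhysics.KineticTheory.PointProcess (laplaceFunctional windowLaw windowRestrict centredBox
  measurable_windowRestrict measurable_exp_neg_finsum)
open Literature.Analysis.FunctionSpaces (PointConfig)

/-! ## Setwise convergence from approximation by a convergent test class under domination -/

/-- **Abstract setwise limit.** Let `P_k, μ` be probability laws, `π` a measurable map with `(P_k) ∘ π⁻¹ ≤ R` for one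
finite measure `R`, and `E` a `π`-invariant event (`π⁻¹ E = E`). If for every `ε > 0` there is a measurable
`π`-invariant `G` with `|G| ≤ 1`, `∫ G dP_k → ∫ G dμ`, and `‖1_E - G‖_{L¹(R)}, ‖1_E - G‖_{L¹(μ)} ≤ ε`, then
`P_k E → μ E`: `|P_k E - ∫ G dP_k| ≤ ∫ |1_E - G| dP_k = ∫ |1_E - G| d(P_k ∘ π⁻¹) ≤ ‖1_E - G‖_{L¹(R)}`. -/
theorem tendsto_measure_of_forall_approx {Ω : Type*} [MeasurableSpace Ω] {P : ℕ → Measure Ω} {μ : Measure Ω}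
    [∀ k, IsProbabilityMeasure (P k)] [IsProbabilityMeasure μ] (D : Measure Ω) [IsFiniteMeasure D] {π : Ω → Ω}
    (hπ : Measurable π) (hdom : ∀ k, (P k).map π ≤ D) {E : Set Ω} (hE : MeasurableSet E) (hEπ : π ⁻¹' E = E)
    (happrox : ∀ ε : ℝ, 0 < ε → ∃ G : Ω → ℝ, Measurable G ∧ (∀ x, |G x| ≤ 1) ∧ (∀ x, G (π x) = G x) ∧
      Tendsto (fun k => ∫ x, G x ∂(P k)) atTop (𝓝 (∫ x, G x ∂μ)) ∧
      ∫ x, |E.indicator 1 x - G x| ∂D ≤ ε ∧ ∫ x, |E.indicator 1 x - G x| ∂μ ≤ ε) :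
    Tendsto (fun k => P k E) atTop (𝓝 (μ E)) := by
  rw [← ENNReal.tendsto_toReal_iff (fun k => measure_ne_top _ _) (measure_ne_top _ _)]
  simp_rw [← measureReal_def]
  rw [Metric.tendsto_atTop]
  intro ε hε
  obtain ⟨G, hGm, hG1, hGπ, hGt, hGD, hGμ⟩ := happrox (ε / 3) (by positivity)
  obtain ⟨N, hN⟩ := Metric.tendsto_atTop.1 hGt (ε / 3) (by positivity)
  refine ⟨N, fun k hk => ?_⟩
  -- integrability bookkeeping
  have hind : ∀ (ρ : Measure Ω) [IsFiniteMeasure ρ], Integrable (E.indicator (1 : Ω → ℝ)) ρ := fun ρ _ =>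
    (integrable_const (1 : ℝ)).indicator hE
  have hGi : ∀ (ρ : Measure Ω) [IsFiniteMeasure ρ], Integrable G ρ := fun ρ _ =>
    Integrable.of_bound hGm.aestronglyMeasurable 1 (ae_of_all _ fun x => by rw [Real.norm_eq_abs]; exact hG1 x)
  have hdiff_m : Measurable fun x => |E.indicator (1 : Ω → ℝ) x - G x| :=
    continuous_abs.measurable.comp ((measurable_const.indicator hE).sub hGm)
  have hdiff_i : ∀ (ρ : Measure Ω) [IsFiniteMeasure ρ], Integrable (fun x => |E.indicator (1 : Ω → ℝ) x - G x|) ρ :=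
    fun ρ _ => ((hind ρ).sub (hGi ρ)).abs
  -- the deviation of the mass of `E` from the integral of `G`, under any probability law
  have hdev : ∀ (ρ : Measure Ω) [IsProbabilityMeasure ρ],
      |ρ.real E - ∫ x, G x ∂ρ| ≤ ∫ x, |E.indicator (1 : Ω → ℝ) x - G x| ∂ρ := by
    intro ρ _
    rw [← integral_indicator_one hE, ← integral_sub (hind ρ) (hGi ρ)]
    exact abs_integral_le_integral_abs
  -- invariance of the integrand under `π`
  have hind_inv : ∀ x, E.indicator (1 : Ω → ℝ) (π x) = E.indicator (1 : Ω → ℝ) x := by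
    intro x
    have hx : π x ∈ E ↔ x ∈ E := by rw [← mem_preimage, hEπ]
    by_cases h : x ∈ E
    · rw [indicator_of_mem h, indicator_of_mem (hx.2 h), Pi.one_apply, Pi.one_apply]
    · rw [indicator_of_notMem h, indicator_of_notMem (mt hx.1 h)]
  have hinv : ∀ x, |E.indicator (1 : Ω → ℝ) (π x) - G (π x)| = |E.indicator (1 : Ω → ℝ) x - G x| := fun x => by
    rw [hGπ x, hind_inv x]
  have h1 : |(P k).real E - ∫ x, G x ∂(P k)| ≤ ε / 3 := by
    refine (hdev (P k)).trans ?_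
    calc ∫ x, |E.indicator (1 : Ω → ℝ) x - G x| ∂(P k)
        = ∫ x, |E.indicator (1 : Ω → ℝ) (π x) - G (π x)| ∂(P k) := by simp_rw [hinv]
      _ = ∫ x, |E.indicator (1 : Ω → ℝ) x - G x| ∂((P k).map π) :=
          (integral_map hπ.aemeasurable hdiff_m.aestronglyMeasurable).symm
      _ ≤ ∫ x, |E.indicator (1 : Ω → ℝ) x - G x| ∂D :=
          integral_mono_measure (hdom k) (ae_of_all _ fun x => abs_nonneg _) (hdiff_i D)
      _ ≤ ε / 3 := hGD
  have h2 : |μ.real E - ∫ x, G x ∂μ| ≤ ε / 3 := (hdev μ).trans hGμ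
  have h3 := hN k hk
  rw [Real.dist_eq] at h3 ⊢
  rw [abs_sub_lt_iff] at h3 ⊢
  rw [abs_le] at h1 h2
  constructor <;> linarith [h1.1, h1.2, h2.1, h2.2, h3.1, h3.2]

/-! ## Locality of linear statistics and of window events -/

/-- Restricting the configuration to a set containing the topological support of `f` does not change `S_f`. -/
theorem sumFn_restrict_of_tsupport_subset {X : Type*} [TopologicalSpace X] (ω : PointConfig X) {s : Set X}
    {f : X → ℝ} (hf : tsupport f ⊆ s) : (ω.restrict s).sumFn f = ω.sumFn f := by
  rw [PointConfig.sumFn_def, PointConfig.sumFn_def]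
  refine finsum_mem_inter_support_eq' f _ _ fun x hx => ?_
  have hxs : x ∈ s := hf (subset_tsupport f hx)
  change x ∈ ω.carrier ∩ s ↔ x ∈ ω.carrier
  exact ⟨fun h => h.1, fun h => ⟨h, hxs⟩⟩

/-- Restricting to `t ⊇ s` and then to `s` is restricting to `s`. -/
theorem restrict_restrict_of_subset {X : Type*} [TopologicalSpace X] {s t : Set X} (hst : s ⊆ t) (ω : PointConfig X) :
    (ω.restrict t).restrict s = ω.restrict s := by
  ext p
  change p ∈ (ω.carrier ∩ t) ∩ s ↔ p ∈ ω.carrier ∩ s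
  exact ⟨fun hp => ⟨hp.1.1, hp.2⟩, fun hp => ⟨⟨hp.1, hst hp.2⟩, hp.2⟩⟩

/-- An open ball of radius `n + 1` around the origin lies in the centred cube `Λ_n = [-(n+1), n+1)³`. -/
theorem ball_subset_centredBox (n : ℕ) : Metric.ball (0 : V3) ((n : ℝ) + 1) ⊆ centredBox (d := Fin 3) n := by
  intro y hy i
  rw [Metric.mem_ball, dist_zero_right] at hy
  have h : |y i| ≤ ‖y‖ := by simpa using PiLp.norm_apply_le y i
  rw [abs_le] at h
  constructor <;> linarith [h.1, h.2]

/-! ## The registered stub -/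

/-- **SETWISE UPGRADE OF VAGUE CONVERGENCE UNDER DOMINATION** (registered stub `stub_setwiseWindowLimit_of_domination`
of line `FirstLemma`, crux stmt-AtomisticToContinuum-14135). If the Laplace functionals of probability laws `P k` on
configurations of `ℝ³ × ℝ³` converge to those of a probability law `μ` on all of `C_c⁺`, and on every centred cube the
window laws of the `P k` are dominated by one finite measure, then the window laws converge SETWISE on every bounded
measurable window `Λ`: `windowLaw Λ (P k) A → windowLaw Λ μ A` for every measurable `A`. (The intensity hypotheses of
the registered signature are not needed: choosing an OPEN ball `U ⊇ Λ` inside a centred cube `Λ_n`, the event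
`E = {ω | ω ∩ (Λ × ℝ³) ∈ A}` is an event of the configuration in the open set `U × ℝ³`, hence — by
`measurable_restrict_iSup_comap` — of the σ-algebra of the exponential statistics `e^{-S_f}`, `f ∈ C_c⁺` supported
inside `U × ℝ³`; by the functional monotone class theorem `stub_cylinderDenseL1` its indicator is `L¹(R + μ)`-close to a
bounded continuous function `G` of finitely many such statistics, whose integrals converge by
`tendsto_integral_bcf_expNegSumFn` (Stone–Weierstrass on Laplace functionals); `E` and `G` only see the configuration
in `Λ_n × ℝ³`, so the domination `windowLaw Λ_n (P k) ≤ R` transfers the `L¹(R)` bound to every `P k` uniformly: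
`tendsto_measure_of_forall_approx`.) -/
theorem stub_setwiseWindowLimit_of_domination :
    ∀ (P : ℕ → Measure (PointConfig (V3 × V3))) (μ : Measure (PointConfig (V3 × V3))) (c : ℝ≥0∞),
      (∀ k, IsProbabilityMeasure (P k)) → IsProbabilityMeasure μ → c ≠ ⊤ →
      (∀ f : V3 × V3 → ℝ, Continuous f → HasCompactSupport f → (∀ p, 0 ≤ f p) →
        Tendsto (fun k => laplaceFunctional (P k) f) atTop (𝓝 (laplaceFunctional μ f))) →
      (∀ (k : ℕ) (B : Set V3), MeasurableSet B →
        ∫⁻ ω, ((ω.count (Prod.fst ⁻¹' B) : ℕ∞) : ℝ≥0∞) ∂(P k) ≤ c * volume B) →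
      (∀ B : Set V3, MeasurableSet B → ∫⁻ ω, ((ω.count (Prod.fst ⁻¹' B) : ℕ∞) : ℝ≥0∞) ∂μ ≤ c * volume B) →
      (∀ n : ℕ, ∃ R : Measure (PointConfig (V3 × V3)), IsFiniteMeasure R ∧ ∀ k, windowLaw (centredBox n) (P k) ≤ R) →
      ∀ Λ : Set V3, MeasurableSet Λ → Bornology.IsBounded Λ → ∀ A : Set (PointConfig (V3 × V3)), MeasurableSet A →
        Tendsto (fun k => windowLaw Λ (P k) A) atTop (𝓝 (windowLaw Λ μ A)) := by
  intro P μ c hP hμ _hc hL _hPint _hμint hdom Λ hΛ hΛb A hA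
  -- an open ball `U ⊇ Λ` inside a centred cube `Λ_n`, and the open phase-space region `V = U × ℝ³`
  obtain ⟨r, hr⟩ := hΛb.subset_ball (0 : V3)
  obtain ⟨n, hn⟩ := exists_nat_ge r
  set U : Set V3 := Metric.ball (0 : V3) ((n : ℝ) + 1) with hU
  have hUo : IsOpen U := Metric.isOpen_ball
  have hΛU : Λ ⊆ U := hr.trans (Metric.ball_subset_ball (by linarith))
  have hUbox : U ⊆ centredBox (d := Fin 3) n := ball_subset_centredBox n
  set V : Set (V3 × V3) := Prod.fst ⁻¹' U with hV
  have hVo : IsOpen V := hUo.preimage continuous_fst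
  have hΛV : (Prod.fst ⁻¹' Λ : Set (V3 × V3)) ⊆ V := preimage_mono hΛU
  have hVbox : V ⊆ Prod.fst ⁻¹' centredBox (d := Fin 3) n := preimage_mono hUbox
  obtain ⟨D, hDfin, hD⟩ := hdom n
  -- the event `E = {ω | ω ∩ (Λ × ℝ³) ∈ A}`
  set E : Set (PointConfig (V3 × V3)) := windowRestrict Λ ⁻¹' A with hE
  have hEm : MeasurableSet E := measurable_windowRestrict hΛ hA
  have hwl : ∀ ρ : Measure (PointConfig (V3 × V3)), windowLaw Λ ρ A = ρ E := fun ρ => by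
    rw [windowLaw, Measure.map_apply (measurable_windowRestrict hΛ) hA]
  simp_rw [hwl]
  have hEbox : windowRestrict (centredBox (d := Fin 3) n) ⁻¹' E = E := by
    ext ω
    simp only [hE, mem_preimage]
    rw [windowRestrict_windowRestrict (hΛU.trans hUbox)]
  have hEV : PointConfig.restrict V ⁻¹' E = E := by
    ext ω
    simp only [hE, mem_preimage]
    rw [show windowRestrict Λ (PointConfig.restrict V ω) = windowRestrict Λ ω from restrict_restrict_of_subset hΛV ω]
  -- the exponential statistics supported inside `V` and the σ-algebra they generate
  set T : {f : V3 × V3 → ℝ // Continuous f ∧ HasCompactSupport f ∧ (∀ x, 0 ≤ f x) ∧ tsupport f ⊆ V} →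
      PointConfig (V3 × V3) → ℝ := fun f ω => Real.exp (-(ω.sumFn f.1)) with hT
  have hTm : ∀ f, Measurable (T f) := fun f => measurable_exp_neg_finsum f.2.1.measurable f.2.2.1 f.2.2.2.1
  have hE𝓜 : MeasurableSet[⨆ f, MeasurableSpace.comap (T f) inferInstance] E := by
    rw [← hEV]
    exact measurable_restrict_iSup_comap hVo hEm
  have hψ : Measurable[⨆ f, MeasurableSpace.comap (T f) inferInstance] (E.indicator (1 : PointConfig (V3 × V3) → ℝ)) :=
    measurable_const.indicator hE𝓜
  have hC : ∀ ω, |E.indicator (1 : PointConfig (V3 × V3) → ℝ) ω| ≤ 1 := fun ω => by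
    by_cases h : ω ∈ E
    · rw [indicator_of_mem h, Pi.one_apply, abs_one]
    · rw [indicator_of_notMem h, abs_zero]; exact zero_le_one
  haveI := hDfin
  -- the abstract setwise limit
  refine tendsto_measure_of_forall_approx D (measurable_windowRestrict (measurableSet_centredBox_fin3 n)) hD hEm hEbox
    fun ε hε => ?_
  -- density of continuous cylinder functions of the statistics (functional monotone class theorem)
  obtain ⟨s, g, hg, hg1, hgε⟩ := stub_cylinderDenseL1 T hTm (D + μ) hψ hC hε
  -- clamp `g` to `[-1, 1]` (no change on the range) to get a bounded continuous function
  set gb : (↥s → ℝ) →ᵇ ℝ := BoundedContinuousFunction.mkOfBound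
    ⟨fun v => max (-1) (min 1 (g v)), continuous_const.max (continuous_const.min hg)⟩ 2 (fun v w => by
      rw [Real.dist_eq, abs_le]
      simp only [ContinuousMap.coe_mk]
      constructor <;>
        nlinarith [le_max_left (-1) (min 1 (g v)), max_le (show (-1 : ℝ) ≤ 1 by norm_num) (min_le_left 1 (g v)),
          le_max_left (-1) (min 1 (g w)), max_le (show (-1 : ℝ) ≤ 1 by norm_num) (min_le_left 1 (g w))]) with hgb
  have hgb_eq : ∀ ω, gb (fun i : ↥s => T i ω) = g (fun i : ↥s => T i ω) := by
    intro ω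
    have h := abs_le.1 (hg1 ω)
    show max (-1) (min 1 (g fun i : ↥s => T i ω)) = g fun i : ↥s => T i ω
    rw [min_eq_right h.2, max_eq_right h.1]
  refine ⟨fun ω => gb (fun i : ↥s => T i ω), gb.continuous.measurable.comp (measurable_pi_lambda _ fun i => hTm i),
    fun ω => ?_, fun ω => ?_, ?_, ?_, ?_⟩
  · -- the bound
    show |max (-1) (min 1 (g fun i : ↥s => T i ω))| ≤ 1
    exact abs_le.2 ⟨le_max_left _ _, max_le (by norm_num) (min_le_left _ _)⟩
  · -- locality: the statistics supported inside `V ⊆ Λ_n × ℝ³` do not see points outside the cube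
    show gb (fun i : ↥s => T i (windowRestrict (centredBox (d := Fin 3) n) ω)) = gb (fun i : ↥s => T i ω)
    refine congr_arg gb (funext fun i => ?_)
    show Real.exp (-(((ω.restrict (Prod.fst ⁻¹' centredBox (d := Fin 3) n))).sumFn i.1.1)) = Real.exp (-(ω.sumFn i.1.1))
    rw [sumFn_restrict_of_tsupport_subset ω (i.1.2.2.2.2.trans hVbox)]
  · -- convergence (Stone–Weierstrass on Laplace functionals)
    exact tendsto_integral_bcf_expNegSumFn hL (f := fun i : ↥s => (i : {f : V3 × V3 → ℝ // Continuous f ∧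
      HasCompactSupport f ∧ (∀ x, 0 ≤ f x) ∧ tsupport f ⊆ V}).1) (fun i => i.1.2.1) (fun i => i.1.2.2.1)
      (fun i => i.1.2.2.2.1) gb
  · -- `L¹(D)` bound
    have hi : ∀ (ρ : Measure (PointConfig (V3 × V3))) [IsFiniteMeasure ρ],
        Integrable (fun ω => |E.indicator (1 : PointConfig (V3 × V3) → ℝ) ω - g (fun i : ↥s => T i ω)|) ρ := by
      intro ρ _
      refine (((integrable_const (1 : ℝ)).indicator hEm).sub (Integrable.of_bound
        ((hg.measurable.comp (measurable_pi_lambda _ fun i => hTm i)).aestronglyMeasurable) 1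
        (ae_of_all _ fun ω => ?_))).abs
      rw [Real.norm_eq_abs]
      exact hg1 ω
    simp_rw [hgb_eq]
    rw [integral_add_measure (hi D) (hi μ)] at hgε
    linarith [integral_nonneg (μ := μ) (f := fun ω => |E.indicator (1 : PointConfig (V3 × V3) → ℝ) ω -
      g (fun i : ↥s => T i ω)|) fun ω => abs_nonneg _]
  · -- `L¹(μ)` bound
    have hi : ∀ (ρ : Measure (PointConfig (V3 × V3))) [IsFiniteMeasure ρ],
        Integrable (fun ω => |E.indicator (1 : PointConfig (V3 × V3) → ℝ) ω - g (fun i : ↥s => T i ω)|) ρ := by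
      intro ρ _
      refine (((integrable_const (1 : ℝ)).indicator hEm).sub (Integrable.of_bound
        ((hg.measurable.comp (measurable_pi_lambda _ fun i => hTm i)).aestronglyMeasurable) 1
        (ae_of_all _ fun ω => ?_))).abs
      rw [Real.norm_eq_abs]
      exact hg1 ω
    simp_rw [hgb_eq]
    rw [integral_add_measure (hi D) (hi μ)] at hgε
    linarith [integral_nonneg (μ := D) (f := fun ω => |E.indicator (1 : PointConfig (V3 × V3) → ℝ) ω -
      g (fun i : ↥s => T i ω)|) fun ω => abs_nonneg _]

end Summit.AtomisticToContinuum.HydrodynamicLimit.Theorems.KiferCompactification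

end
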